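import Literature.MathematicalPhysics.QuantumFieldTheory.Balaban1983to89.B9Eq3105Coords

/-!
# `Balaban1983to89.B9Eq3105OfLocalInverse` — T. Bałaban, *Propagators for lattice gauge theories in a background field*, Commun. Math. Phys. **99** (1985)
# 389–434 [Balaban1985BackgroundPropagators], (3.105) p. 414 «Δ_aG₀ = I − R» AND ITS TRANSPOSE FOR AN ARBITRARY FAMILY OF CUBE LETTERS `O_□` WHOSE
# LOCAL-INVERSE LAWS HOLD UP TO A DISPLAYED DEFECT — (3.105) with a FIFTH sum; in any ring, at def-Y's `Δ_a(U)`, in `End_ℝ`, and in the real coordinates of a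
# basis `b` (cell `lit-balaban`, sub-row G-B9-LETTERS, module M5.7, the (QB1) re-cut of the bond consumer; seat p38 gen 41)

statement-level skeleton of published theorems with citation tags; proofs where landed; nothing here is a claim about the Yang–Mills mass gap

CITATION HEADER (lean-in-tree rule).  B9 = T. Bałaban, *Propagators for lattice gauge theories in a background field*, Commun. Math. Phys. **99** (1985)
389–434 (PDF held: `paper:balaban1985-cmp99-background-propagators`, journal page = PDF page + 388).  p. 414 (3.105): «Δ_aG₀ = I − Σ_□K(h_□)G_□h_□ −
Σ_□(1 − ζ_□̃)DPD*h_□G_□h_□ − Σ_□ζ_□̃(DPD* − DP_□D*)h_□G_□h_□ − Σ_□ζ_□̃P_{□,1}(∂h_□)G_□h_□ = I − R»; (3.104) p. 414 «Δ_a hA = hΔ_a − K(h)A − P₁(∂h)A»; (3.101)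
p. 414 «(DPD*hA)_μ(x) = h(x)(DPD*A)_μ(x) + (P₁(∂h)A)_μ(x)»; p. 414 «DRD* = DD* − DPD*»; (3.87) p. 409 «G₀ = Σ_{□∈𝒟} h_□G_□h_□»; p. 408 «Σ_□ h_□² = 1»; p. 409
l. 3–5 «The operators constructed for this sequence, which we denote by G′_□(U), C_□(U) = (Q(U)G′_□²(U)Q*(U))⁻¹, G_□(U), satisfy all the inequalities of Theorems
3.1–3.3 correspondingly»; p. 410 l. 14–15 «A propagator G′_□ depends on U restricted to Ω₀(□) ⊂ □̃⁵, and the operator K(h_□) is semi-local»; (3.27) p. 395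
«G(U) = Δ_a(U)⁻¹».  [4] = [Balaban1984PropagatorsII] (2.52) p. 232 («A summation preserves it also»).
Rows B9.Eq3.105 × B9.Thm3.10 × B9.Eq3.87 (cells only; no row head changes).

WHY THIS FILE (the (QB1) re-cut, cell HOME∕INBOX 2026-08-28 11:25:24Z ym-inputs-p02 (F1-B), 11:28:22Z r05 g83 (c)–(d), 11:46:58Z p21 g34 «(QB1) ANSWER: YES … OWNER:
p38 lineage (6-B author)»).  The bond-sector consumer of record — this seat's `B9Thm310GTorusRegularCover.eBlock_kernelFamilyBInv_GAY_of_cover` ∕ `…CoverCubes` ∕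
`B9Thm310TransposedCommutatorBMajorant.eBlock_kernelFamilyBInv_GAY_of_coverCubes'` — fixes the cube letter to r05's WHOLE-TORUS `G_□(U₁) = GACubeY i □ parS parB (cfg U₁)
= Δ_{a,□}(U₁)⁻¹` and displays `hinvC : IsUnit (Δ_{a,□}(U₁))` at the class background `U₁`; that invertibility has no proof road at a background that is only
class-regular off the cube (p02 memo v1.4 (F1-B); r05: «not because hinvC is false» — a design choice), whereas print's `G_□` is the propagator of the LOCALISED cube
sequence `{Ω_n(□)}` depending on `U` restricted to `Ω₀(□) ⊂ □̃⁵` only (p. 410 l. 14–15).  The site-sector consumer (p21's M5.5 FILE 6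
`B9Thm37GpTorusRegularFinal.eBlock_kernelFamilySInv_Gp_of_localInverse`) instead quantifies over an ARBITRARY per-cube letter family `O_□` with the two LOCAL-INVERSE
LAWS displayed — exactly what let p33 plug the cut, transported letter at the localised field.  THIS FILE is the algebraic half of the same re-cut for the bond
sector: (3.105) and its transpose for ANY cube letters `Gl □`, ANY local projection letters `Pl □` (print's `DP_□D*`) with their (3.101) commutators `P1l □`
(`Pl_□·M_{h_□} = M_{h_□}·Pl_□ + P1l_□`), and the local-inverse laws holding UP TO DISPLAYED DEFECTS `E_□`, `E♯_□`:
`M_{h_□}(Δ_loc − Pl_□)Gl_□M_{h_□} = M_{h_□}² − E_□`, `M_{h_□}Gl_□(Δ_loc − Pl_□)M_{h_□} = M_{h_□}² − E♯_□` — then (3.105) reads `Δ_a·G₀ = 1 − (R¹ + R² + R³ + R⁴) − Σ_□E_□`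
and its transpose `G₀·Δ_a = 1 − (V¹ + V² + V³ + V⁴) − Σ_□E♯_□`.  WHY A DEFECT (an (R)-DESIGN TERM, NOT IN PRINT; the bond twin of cell GAPS G-B9-p21-01's inner
defect): for print's letters and for r05's `GACubeY` the laws are EXACT (`E ≡ 0`: `B9Eq3105AtLetters.hloc_GACubeY`, `B9Eq3105TAtLetters.hlocT_GACubeY` with the NearH
rows∕columns agreement of `B9CubeBondRowAgreementNearH`); but a both-sided cut letter `χ_□·𝒰⁻¹G_□(Ṽ_□)𝒰·χ_□` (p02 memo v1.4 §B (i), p33's site design) cannot satisfy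
the exact law because `Δ_{a,□}` is NOT local — it contains `D R_□ D*`, `R_□ = G′_□Q′*C_□Q′G′_□` ((3.25) p. 394, (3.26) p. 395) — so `M_{h_□}Δ_{a,□}(Ṽ)(1 − χ_□)G_□(Ṽ) ≠ 0`, of
size `e^{−δ₀·d(supp h_□, supp(1 − χ_□))}`; the site sector's `Δ′_a` is local, whence p33's exact `B9Cor36GpCubeLocLetter.localInverse_laws_of_agree`.  Precedent for
the design: p21's `B9Thm39CinvDefect` ((3.95) with a fourth sum, `hdef` displayed).

WHAT IS PROVED (all `theorem`s, 0 `def`, 0 sorry, 0 new named facts).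
* §1 (any ring) `eq3105_sum_defect`, `eq3105T_sum_defect` — b09's `B9Eq3105Sum.eq3105_sum` and this seat's `B9Eq3105TAtLetters.eq3105T_sum` with the local-inverse
  relation replaced by its defect form; the printed four families unchanged, a fifth sum `Σ_□E_□` (resp. `Σ_□E♯_□`) subtracted.
* §2 (at def-Y's `Δ_a(U) = Δ_loc(U) − DPD*(U)`, any partition family `hf` with `Σ hf² = 1`, any `ζ = 1 on supp hf`) ★ `eq3105_deltaAY_defect`, ★ `eq3105T_deltaAY_defect`.
* §3 (partition of record `h_□ = hTY i □`) `eq3105_hT_defect`, `eq3105T_hT_defect`; the EXACT-law specialisations `eq3105_hT_ofLocalInverse`, `eq3105T_hT_ofLocalInverse`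
  (four families, no fifth sum); and the record letters as an instance: `hdef_GACubeY`, `hdefT_GACubeY` (`E ≡ 0` from `IsUnit Δ_{a,□}(U)` + NearH).
* §4 (`End_ℂ → End_ℝ`) `eq3105_restrict_defect`, `eq3105T_restrict_defect`.
* §5 (real coordinates of a basis `b`, cut-offs as `mulOp`) ★★ `eq3105_conj_defect`, ★★ `eq3105T_conj_defect` — the `h388`∕`h388T` inputs of the summation engines
  `B9Thm310GTorusRegular.thm310_entry1`, `B9Thm310GTorusRegularEntries.thm310_leftEntry∕rightEntry` for generic letters (the `hinv`∕`hinvT` inputs are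
  `B9Eq3105Coords.conj_GAY_mul_deltaAY` ∕ `conj_deltaAY_mul_GAY`, unchanged).

HONEST SCOPE.  Pure algebra: identities, no estimate.  The defect families are design terms (zero for print's letters); the cut-offs `ζ_□̃` are ANY family equal
to `1` on `supp h_□`; the smallness of the families (p. 414–415; cell GAPS G-B9-05∕06a∕07; the first family = this seat's E′ chain) is NOT touched; nothing
continuum ∕ OS ∕ mass gap ∕ Clay; YM mass gap NOT proved by any of this (Track A conditional rung).  `--supports stmt-QuantumFields-19200`.
RELATED, NOT DUPLICATED (searched 2026-08-28: `lean search 'eq3105.*defect|3105.*ofLocalInverse|hdef_GACubeY' --decl` = ∅): `B9Eq3105Sum` (exact law, any ring),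
`B9Eq3105AtLetters` ∕ `…TAtLetters` (exact law, generic letters), `…NearH` (record letters), `B9Eq3105Coords` (record letters in real coordinates).
-/

noncomputable section

namespace Literature.MathematicalPhysics.QuantumFieldTheory.Balaban1983to89.B9Eq3105OfLocalInverse

open Node00
open B9Thm37Sum (mulOp)
open B9Thm37CubeCoverCommutators (cutMulY cutMulY_apply hTY hTY_apply sum_hTY_sq sum_cutMulY_mul_self)
open B9Eq3104CutoffCommutators (cutCommR comp_cutMulY_eq_sub hBdY hBdY_apply deltaLocY DPDsY KhBY deltaAY_eq_loc_sub)
open B9CubeLettersBondOpsL0 (deltaACubeY GACubeY)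
open B9Eq3105AtLetters (DPDsCubeY P1CubeY deltaLocY_mul_cutMulY cutMulY_mul_cutMulY_of_eq_one DPDsCubeY_mul_cutMulY hloc_GACubeY)
open B9Eq3105TAtLetters (cutMulY_mul_cutMulY_of_eq_one' hlocT_GACubeY)
open B9CubeBondRowAgreementNearH (QsaQCubeY_apply_eq_of_hT)
open B9Eq3105TAtLettersNearH (QsaQCubeY_cutMulY_hT_apply_eq)
open B9Eq352DivFormLetters (conj conj_sub conj_neg)
open B9Eq352GradLetters (conj_add)
open B9Thm37GpTorusRegular (conj_one conj_sum)
open B9Thm39CinvTorusRegular (conj_cutMulY)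
open B6KLevelCensusIndexV1 (KIdx)
open B6Cover236MultiLevelBlocks (cubes)
open Node00.OpsYNablaBridge (chartY)
open scoped Matrix

/-! ## §1 (3.105) and its transpose in any ring, the local-inverse relation holding up to a defect -/

section Abstract

variable {A : Type*} [Ring A] {κ : Type} [Fintype κ]

/-- **(3.105) WITH A DEFECT FAMILY, in any ring.**  Data per cube `□ = c`: `h_□` (`Hm`), `ζ_□̃` (`Z`), the cube letter `G_□` (`Gl`), `K(h_□)` (`Kh`), the local projector
term (`Ploc`, print's `DP_□D*`) and its commutator `P_{□,1}(∂h_□)` (`P1`), the local-inverse DEFECT `E_□` (`E`); global: the P-free part `Λ` and `DPD*` (`Pg`), so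
`Δ_a = Λ − DPD*`.  Hypotheses: (3.104) for `Λ` (`h104`), (3.101) (`h101`), `ζ_□̃h_□ = h_□` (`hζ`), the local-inverse relation UP TO THE DEFECT
`h_□(Λ − DP_□D*)G_□h_□ = h_□² − E_□` (`hdef`; `E ≡ 0` is b09's `B9Eq3105Sum.eq3105_sum`) and `Σ_□h²_□ = 1` (`hpu`).  Conclusion: the printed four sums and a fifth,
`Δ_aG₀ = I − Σ_□K(h_□)G_□h_□ − Σ_□(1 − ζ_□̃)DPD*h_□G_□h_□ − Σ_□ζ_□̃(DPD* − DP_□D*)h_□G_□h_□ − Σ_□ζ_□̃P_{□,1}(∂h_□)G_□h_□ − Σ_□E_□`.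
DEFECT LABEL: the defect family `Σ_□E_□` (resp. `Σ_□E♯_□`) is an (R)-design term, NOT in print; `= 0` for print's `G_□ = (Δ_{loc,□} − DP_□D*)⁻¹` on the cube sequence (p. 409 l. 3–5) and for r05's `GACubeY` letters. [cite: Balaban1985BackgroundPropagators, (3.105) p.414, (3.104) p.414, (3.101) p.414, (3.87) p.409, p.408 («Σ h_□² = 1»)] -/
theorem eq3105_sum_defect (Λ Pg : A) (Hm Z Gl Kh Ploc P1 E : κ → A) (h104 : ∀ c, Λ * Hm c = Hm c * Λ - Kh c)
    (h101 : ∀ c, Ploc c * Hm c = Hm c * Ploc c + P1 c) (hζ : ∀ c, Z c * Hm c = Hm c)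
    (hdef : ∀ c, Hm c * (Λ - Ploc c) * Gl c * Hm c = Hm c * Hm c - E c) (hpu : ∑ c, Hm c * Hm c = 1) :
    (Λ - Pg) * ∑ c, Hm c * Gl c * Hm c =
      1 - ∑ c, Kh c * Gl c * Hm c - ∑ c, (1 - Z c) * Pg * (Hm c * Gl c * Hm c) -
        ∑ c, Z c * (Pg - Ploc c) * (Hm c * Gl c * Hm c) - ∑ c, Z c * P1 c * Gl c * Hm c - ∑ c, E c := by
  have hterm : ∀ c, (Λ - Pg) * (Hm c * Gl c * Hm c) = Hm c * Hm c - E c - (Kh c * Gl c * Hm c +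
      (1 - Z c) * Pg * (Hm c * Gl c * Hm c) + Z c * (Pg - Ploc c) * (Hm c * Gl c * Hm c) +
        Z c * P1 c * Gl c * Hm c) := by
    intro c
    have e1 : (Λ - Pg) * (Hm c * Gl c * Hm c) = (Λ * Hm c) * Gl c * Hm c -
        ((1 - Z c) * Pg * (Hm c * Gl c * Hm c) + Z c * (Pg - Ploc c) * (Hm c * Gl c * Hm c) +
          Z c * (Ploc c * Hm c) * Gl c * Hm c) := by noncomm_ring
    have e2 : Z c * (Hm c * Ploc c + P1 c) * Gl c * Hm c =
        (Z c * Hm c) * Ploc c * Gl c * Hm c + Z c * P1 c * Gl c * Hm c := by noncomm_ring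
    rw [h104 c, h101 c, e2, hζ c] at e1
    rw [e1, ← hdef c]
    noncomm_ring
  rw [Finset.mul_sum, Finset.sum_congr rfl fun c _ => hterm c]
  simp only [Finset.sum_sub_distrib, Finset.sum_add_distrib, hpu]
  abel

/-- **(3.105) TRANSPOSED WITH A DEFECT FAMILY, in any ring**: data as in `eq3105_sum_defect`, the RIGHT local-inverse relation up to the defect `E♯_□`
(`hdefT : h_□G_□(Λ − DP_□D*)h_□ = h_□² − E♯_□`; `E♯ ≡ 0` is `B9Eq3105TAtLetters.eq3105T_sum`), `h_□ζ_□̃ = h_□`.  Conclusion: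
`G₀(Λ − DPD*) = 1 + Σ_□ h_□G_□K(h_□) + Σ_□ h_□G_□P_{□,1} − Σ_□ h_□G_□h_□·ζ_□̃(DPD* − DP_□D*) − Σ_□ h_□G_□h_□·(1 − ζ_□̃)DPD* − Σ_□E♯_□`.
(transposed reading — bookkeeping; print displays only the left form of (3.105)) DEFECT LABEL: the defect family `Σ_□E_□` (resp. `Σ_□E♯_□`) is an (R)-design term, NOT in print; `= 0` for print's `G_□ = (Δ_{loc,□} − DP_□D*)⁻¹` on the cube sequence (p. 409 l. 3–5) and for r05's `GACubeY` letters. [cite: Balaban1985BackgroundPropagators, (3.105) p.414, (3.104) p.414, (3.101) p.414, (3.87) p.409] -/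
theorem eq3105T_sum_defect (Λ Pg : A) (Hm Z Gl Kh Ploc P1 E : κ → A) (h104 : ∀ c, Λ * Hm c = Hm c * Λ - Kh c)
    (h101 : ∀ c, Ploc c * Hm c = Hm c * Ploc c + P1 c) (hζ : ∀ c, Hm c * Z c = Hm c)
    (hdefT : ∀ c, Hm c * Gl c * (Λ - Ploc c) * Hm c = Hm c * Hm c - E c) (hpu : ∑ c, Hm c * Hm c = 1) :
    (∑ c, Hm c * Gl c * Hm c) * (Λ - Pg) =
      1 + ∑ c, Hm c * Gl c * Kh c + ∑ c, Hm c * Gl c * P1 c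
        - ∑ c, Hm c * Gl c * Hm c * (Z c * (Pg - Ploc c))
        - ∑ c, Hm c * Gl c * Hm c * ((1 - Z c) * Pg) - ∑ c, E c := by
  have hΛ' : ∀ c, Hm c * Λ = Λ * Hm c + Kh c := fun c => by rw [h104 c, sub_add_cancel]
  have hP' : ∀ c, Hm c * Ploc c = Ploc c * Hm c - P1 c := fun c => by rw [h101 c, add_sub_cancel_right]
  have hterm : ∀ c, Hm c * Gl c * Hm c * (Λ - Pg) = Hm c * Hm c - E c + (Hm c * Gl c * Kh c + Hm c * Gl c * P1 c
      - Hm c * Gl c * Hm c * (Z c * (Pg - Ploc c)) - Hm c * Gl c * Hm c * ((1 - Z c) * Pg)) := by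
    intro c
    have e1 : Hm c * Gl c * Hm c * (Λ - Pg) = Hm c * Gl c * (Hm c * Λ) - Hm c * Gl c * Hm c * (Z c * (Pg - Ploc c))
        - Hm c * Gl c * Hm c * ((1 - Z c) * Pg) - Hm c * Gl c * ((Hm c * Z c) * Ploc c) := by noncomm_ring
    rw [hΛ' c, hζ c, hP' c] at e1
    rw [e1, ← hdefT c]
    noncomm_ring
  rw [Finset.sum_mul, Finset.sum_congr rfl fun c _ => hterm c]
  simp only [Finset.sum_sub_distrib, Finset.sum_add_distrib, hpu]
  abel

end Abstract

variable {d ℓ : ℕ} {hd : 1 ≤ d + 1} {hL : Odd (ℓ + 1) ∧ 1 < ℓ + 1} {b₀ b₁ : ℝ}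
variable {𝔸 : Type} [NormedRing 𝔸] [NormedAlgebra ℂ 𝔸] [CompleteSpace 𝔸]
variable (i : KIdx d ℓ hd hL b₀ b₁)

/-! ## §2 At def-Y's `Δ_a(U)`: any partition family, any cut-offs, any cube letters with the defect laws -/

section Generic

/-- ★ **(3.105) AT `Δ_a(U)` WITH A DEFECT FAMILY, GENERIC FORM**: for ANY real family `hf` with `Σ_□ hf_□² = 1` (read on bonds at `b₋`), ANY cut-offs `ζ_□ = 1` wherever
`hf_□ ≠ 0`, ANY cube letters `Gl_□`, local projection letters `Pl_□` with commutators `P1l_□` (`Pl_□·M_h = M_h·Pl_□ + P1l_□`, (3.101)), and defects `E_□` with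
`M_h(Δ_loc(U) − Pl_□)Gl_□M_h = M_h² − E_□`:
`Δ_a(U)·Σ_□ h_□Gl_□h_□ = 1 − Σ_□K(h_□)(U)Gl_□h_□ − Σ_□(1 − ζ_□)DPD*(U)(h_□Gl_□h_□) − Σ_□ζ_□(DPD*(U) − Pl_□)(h_□Gl_□h_□) − Σ_□ζ_□P1l_□Gl_□h_□ − Σ_□E_□`.
DEFECT LABEL: the defect family `Σ_□E_□` (resp. `Σ_□E♯_□`) is an (R)-design term, NOT in print; `= 0` for print's `G_□ = (Δ_{loc,□} − DP_□D*)⁻¹` on the cube sequence (p. 409 l. 3–5) and for r05's `GACubeY` letters. [cite: Balaban1985BackgroundPropagators, (3.105) p.414, (3.104) p.414, (3.101) p.414, (3.87) p.409, p.408 («Σ h_□² = 1»)] -/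
theorem eq3105_deltaAY_defect (parS : SiteParY 𝔸 i) (parB : BondParY 𝔸 i) (Gp : SiteOpY 𝔸 i) (U : CfgY 𝔸 i) {κ : Type} [Fintype κ]
    (hf : κ → SiteY i → ℝ) (hsq : ∀ z, ∑ c, hf c z ^ 2 = 1) (ζ : κ → SiteY i → ℝ) (hζ : ∀ c z, hf c z ≠ 0 → ζ c z = 1)
    (Gl Pl P1l E : κ → Module.End ℂ (FBondY i → 𝔸))
    (hP1 : ∀ c, Pl c * cutMulY (hBdY i (hf c)) = cutMulY (hBdY i (hf c)) * Pl c + P1l c)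
    (hdef : ∀ c, cutMulY (hBdY i (hf c)) * (deltaLocY i parB U - Pl c) * Gl c * cutMulY (hBdY i (hf c)) =
      cutMulY (hBdY i (hf c)) * cutMulY (hBdY i (hf c)) - E c) :
    deltaAY i parS parB Gp U * ∑ c, cutMulY (hBdY i (hf c)) * Gl c * cutMulY (hBdY i (hf c)) =
      1 - ∑ c, KhBY i (hf c) parB U * Gl c * cutMulY (hBdY i (hf c))
        - ∑ c, (1 - cutMulY (hBdY i (ζ c))) * DPDsY i parS Gp U * (cutMulY (hBdY i (hf c)) * Gl c * cutMulY (hBdY i (hf c)))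
        - ∑ c, cutMulY (hBdY i (ζ c)) * (DPDsY i parS Gp U - Pl c) * (cutMulY (hBdY i (hf c)) * Gl c * cutMulY (hBdY i (hf c)))
        - ∑ c, cutMulY (hBdY i (ζ c)) * P1l c * Gl c * cutMulY (hBdY i (hf c))
        - ∑ c, E c := by
  rw [deltaAY_eq_loc_sub]
  exact eq3105_sum_defect (deltaLocY i parB U) (DPDsY i parS Gp U) (fun c => cutMulY (hBdY i (hf c))) (fun c => cutMulY (hBdY i (ζ c)))
    Gl (fun c => KhBY i (hf c) parB U) Pl P1l E (fun c => deltaLocY_mul_cutMulY i (hf c) parB U) hP1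
    (fun c => cutMulY_mul_cutMulY_of_eq_one (hBdY i (ζ c)) (hBdY i (hf c)) fun b hb => hζ c (chartY i b.src) hb) hdef
    (sum_cutMulY_mul_self (fun c => hBdY i (hf c)) fun b => hsq (chartY i b.src))

/-- ★ **(3.105) TRANSPOSED AT `Δ_a(U)` WITH A DEFECT FAMILY, GENERIC FORM**: data as in `eq3105_deltaAY_defect`, RIGHT defects `E♯_□` with
`M_hGl_□(Δ_loc(U) − Pl_□)M_h = M_h² − E♯_□`:
`(Σ_□ h_□Gl_□h_□)·Δ_a(U) = 1 + Σ_□ h_□Gl_□K(h_□)(U) + Σ_□ h_□Gl_□P1l_□ − Σ_□ h_□Gl_□h_□·ζ_□(DPD*(U) − Pl_□) − Σ_□ h_□Gl_□h_□·(1 − ζ_□)DPD*(U) − Σ_□E♯_□`.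
(transposed reading — bookkeeping; print displays only the left form of (3.105)) DEFECT LABEL: the defect family `Σ_□E_□` (resp. `Σ_□E♯_□`) is an (R)-design term, NOT in print; `= 0` for print's `G_□ = (Δ_{loc,□} − DP_□D*)⁻¹` on the cube sequence (p. 409 l. 3–5) and for r05's `GACubeY` letters. [cite: Balaban1985BackgroundPropagators, (3.105) p.414, (3.104) p.414, (3.101) p.414, (3.87) p.409, p.408] -/
theorem eq3105T_deltaAY_defect (parS : SiteParY 𝔸 i) (parB : BondParY 𝔸 i) (Gp : SiteOpY 𝔸 i) (U : CfgY 𝔸 i) {κ : Type} [Fintype κ]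
    (hf : κ → SiteY i → ℝ) (hsq : ∀ z, ∑ c, hf c z ^ 2 = 1) (ζ : κ → SiteY i → ℝ) (hζ : ∀ c z, hf c z ≠ 0 → ζ c z = 1)
    (Gl Pl P1l E : κ → Module.End ℂ (FBondY i → 𝔸))
    (hP1 : ∀ c, Pl c * cutMulY (hBdY i (hf c)) = cutMulY (hBdY i (hf c)) * Pl c + P1l c)
    (hdefT : ∀ c, cutMulY (hBdY i (hf c)) * Gl c * (deltaLocY i parB U - Pl c) * cutMulY (hBdY i (hf c)) =
      cutMulY (hBdY i (hf c)) * cutMulY (hBdY i (hf c)) - E c) :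
    (∑ c, cutMulY (hBdY i (hf c)) * Gl c * cutMulY (hBdY i (hf c))) * deltaAY i parS parB Gp U =
      1 + ∑ c, cutMulY (hBdY i (hf c)) * Gl c * KhBY i (hf c) parB U
        + ∑ c, cutMulY (hBdY i (hf c)) * Gl c * P1l c
        - ∑ c, cutMulY (hBdY i (hf c)) * Gl c * cutMulY (hBdY i (hf c)) * (cutMulY (hBdY i (ζ c)) * (DPDsY i parS Gp U - Pl c))
        - ∑ c, cutMulY (hBdY i (hf c)) * Gl c * cutMulY (hBdY i (hf c)) * ((1 - cutMulY (hBdY i (ζ c))) * DPDsY i parS Gp U)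
        - ∑ c, E c := by
  rw [deltaAY_eq_loc_sub]
  exact eq3105T_sum_defect (deltaLocY i parB U) (DPDsY i parS Gp U) (fun c => cutMulY (hBdY i (hf c))) (fun c => cutMulY (hBdY i (ζ c)))
    Gl (fun c => KhBY i (hf c) parB U) Pl P1l E (fun c => deltaLocY_mul_cutMulY i (hf c) parB U) hP1
    (fun c => cutMulY_mul_cutMulY_of_eq_one' (hBdY i (hf c)) (hBdY i (ζ c)) fun b hb => hζ c (chartY i b.src) hb) hdefT
    (sum_cutMulY_mul_self (fun c => hBdY i (hf c)) fun b => hsq (chartY i b.src))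

end Generic

/-! ## §3 At the partition of record `h_□ = hTY i □`: defect form, exact-law form, and the record letters as an instance -/

section Record

/-- (3.105) with a defect family at the partition of record `h_□ = hTY i □` (`Σ_□ h_□² = 1`: `sum_hTY_sq`), the cube index = the cover cubes of record.
DEFECT LABEL: the defect family `Σ_□E_□` (resp. `Σ_□E♯_□`) is an (R)-design term, NOT in print; `= 0` for print's `G_□ = (Δ_{loc,□} − DP_□D*)⁻¹` on the cube sequence (p. 409 l. 3–5) and for r05's `GACubeY` letters. [cite: Balaban1985BackgroundPropagators, (3.105) p.414, (3.87) p.409, p.408] -/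
theorem eq3105_hT_defect (parS : SiteParY 𝔸 i) (parB : BondParY 𝔸 i) (Gp : SiteOpY 𝔸 i) (U : CfgY 𝔸 i)
    (ζ : ↥(cubes i.D.toDomains) → SiteY i → ℝ) (hζ : ∀ c z, hTY i c z ≠ 0 → ζ c z = 1)
    (Gl Pl P1l E : ↥(cubes i.D.toDomains) → Module.End ℂ (FBondY i → 𝔸))
    (hP1 : ∀ c, Pl c * cutMulY (hBdY i (hTY i c)) = cutMulY (hBdY i (hTY i c)) * Pl c + P1l c)
    (hdef : ∀ c, cutMulY (hBdY i (hTY i c)) * (deltaLocY i parB U - Pl c) * Gl c * cutMulY (hBdY i (hTY i c)) =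
      cutMulY (hBdY i (hTY i c)) * cutMulY (hBdY i (hTY i c)) - E c) :
    deltaAY i parS parB Gp U * ∑ c, cutMulY (hBdY i (hTY i c)) * Gl c * cutMulY (hBdY i (hTY i c)) =
      1 - ∑ c, KhBY i (hTY i c) parB U * Gl c * cutMulY (hBdY i (hTY i c))
        - ∑ c, (1 - cutMulY (hBdY i (ζ c))) * DPDsY i parS Gp U * (cutMulY (hBdY i (hTY i c)) * Gl c * cutMulY (hBdY i (hTY i c)))
        - ∑ c, cutMulY (hBdY i (ζ c)) * (DPDsY i parS Gp U - Pl c) * (cutMulY (hBdY i (hTY i c)) * Gl c * cutMulY (hBdY i (hTY i c)))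
        - ∑ c, cutMulY (hBdY i (ζ c)) * P1l c * Gl c * cutMulY (hBdY i (hTY i c))
        - ∑ c, E c :=
  eq3105_deltaAY_defect i parS parB Gp U (hTY i) (sum_hTY_sq i) ζ hζ Gl Pl P1l E hP1 hdef

/-- (3.105) transposed with a defect family at the partition of record. (transposed reading — bookkeeping; print displays only the left form of (3.105)) DEFECT LABEL: the defect family `Σ_□E_□` (resp. `Σ_□E♯_□`) is an (R)-design term, NOT in print; `= 0` for print's `G_□ = (Δ_{loc,□} − DP_□D*)⁻¹` on the cube sequence (p. 409 l. 3–5) and for r05's `GACubeY` letters. [cite: Balaban1985BackgroundPropagators, (3.105) p.414, (3.87) p.409, p.408] -/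
theorem eq3105T_hT_defect (parS : SiteParY 𝔸 i) (parB : BondParY 𝔸 i) (Gp : SiteOpY 𝔸 i) (U : CfgY 𝔸 i)
    (ζ : ↥(cubes i.D.toDomains) → SiteY i → ℝ) (hζ : ∀ c z, hTY i c z ≠ 0 → ζ c z = 1)
    (Gl Pl P1l E : ↥(cubes i.D.toDomains) → Module.End ℂ (FBondY i → 𝔸))
    (hP1 : ∀ c, Pl c * cutMulY (hBdY i (hTY i c)) = cutMulY (hBdY i (hTY i c)) * Pl c + P1l c)
    (hdefT : ∀ c, cutMulY (hBdY i (hTY i c)) * Gl c * (deltaLocY i parB U - Pl c) * cutMulY (hBdY i (hTY i c)) =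
      cutMulY (hBdY i (hTY i c)) * cutMulY (hBdY i (hTY i c)) - E c) :
    (∑ c, cutMulY (hBdY i (hTY i c)) * Gl c * cutMulY (hBdY i (hTY i c))) * deltaAY i parS parB Gp U =
      1 + ∑ c, cutMulY (hBdY i (hTY i c)) * Gl c * KhBY i (hTY i c) parB U
        + ∑ c, cutMulY (hBdY i (hTY i c)) * Gl c * P1l c
        - ∑ c, cutMulY (hBdY i (hTY i c)) * Gl c * cutMulY (hBdY i (hTY i c)) * (cutMulY (hBdY i (ζ c)) * (DPDsY i parS Gp U - Pl c))
        - ∑ c, cutMulY (hBdY i (hTY i c)) * Gl c * cutMulY (hBdY i (hTY i c)) * ((1 - cutMulY (hBdY i (ζ c))) * DPDsY i parS Gp U)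
        - ∑ c, E c :=
  eq3105T_deltaAY_defect i parS parB Gp U (hTY i) (sum_hTY_sq i) ζ hζ Gl Pl P1l E hP1 hdefT

/-- the EXACT-law specialisation (`E ≡ 0`): (3.105) at the partition of record for generic letters with `M_h(Δ_loc − Pl_□)Gl_□M_h = M_h²` — the four printed families only.
[cite: Balaban1985BackgroundPropagators, (3.105) p.414, (3.87) p.409, p.408] -/
theorem eq3105_hT_ofLocalInverse (parS : SiteParY 𝔸 i) (parB : BondParY 𝔸 i) (Gp : SiteOpY 𝔸 i) (U : CfgY 𝔸 i)
    (ζ : ↥(cubes i.D.toDomains) → SiteY i → ℝ) (hζ : ∀ c z, hTY i c z ≠ 0 → ζ c z = 1)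
    (Gl Pl P1l : ↥(cubes i.D.toDomains) → Module.End ℂ (FBondY i → 𝔸))
    (hP1 : ∀ c, Pl c * cutMulY (hBdY i (hTY i c)) = cutMulY (hBdY i (hTY i c)) * Pl c + P1l c)
    (hloc : ∀ c, cutMulY (hBdY i (hTY i c)) * (deltaLocY i parB U - Pl c) * Gl c * cutMulY (hBdY i (hTY i c)) =
      cutMulY (hBdY i (hTY i c)) * cutMulY (hBdY i (hTY i c))) :
    deltaAY i parS parB Gp U * ∑ c, cutMulY (hBdY i (hTY i c)) * Gl c * cutMulY (hBdY i (hTY i c)) =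
      1 - ∑ c, KhBY i (hTY i c) parB U * Gl c * cutMulY (hBdY i (hTY i c))
        - ∑ c, (1 - cutMulY (hBdY i (ζ c))) * DPDsY i parS Gp U * (cutMulY (hBdY i (hTY i c)) * Gl c * cutMulY (hBdY i (hTY i c)))
        - ∑ c, cutMulY (hBdY i (ζ c)) * (DPDsY i parS Gp U - Pl c) * (cutMulY (hBdY i (hTY i c)) * Gl c * cutMulY (hBdY i (hTY i c)))
        - ∑ c, cutMulY (hBdY i (ζ c)) * P1l c * Gl c * cutMulY (hBdY i (hTY i c)) := by
  have h := eq3105_hT_defect i parS parB Gp U ζ hζ Gl Pl P1l (fun _ => 0) hP1 (fun c => by rw [hloc c, sub_zero])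
  rw [Finset.sum_const_zero, sub_zero] at h
  exact h

/-- the EXACT-law specialisation of the transposed identity (`E♯ ≡ 0`). (transposed reading — bookkeeping; print displays only the left form of (3.105)) DEFECT LABEL: the defect family `Σ_□E_□` (resp. `Σ_□E♯_□`) is an (R)-design term, NOT in print; `= 0` for print's `G_□ = (Δ_{loc,□} − DP_□D*)⁻¹` on the cube sequence (p. 409 l. 3–5) and for r05's `GACubeY` letters. [cite: Balaban1985BackgroundPropagators, (3.105) p.414, (3.87) p.409, p.408] -/
theorem eq3105T_hT_ofLocalInverse (parS : SiteParY 𝔸 i) (parB : BondParY 𝔸 i) (Gp : SiteOpY 𝔸 i) (U : CfgY 𝔸 i)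
    (ζ : ↥(cubes i.D.toDomains) → SiteY i → ℝ) (hζ : ∀ c z, hTY i c z ≠ 0 → ζ c z = 1)
    (Gl Pl P1l : ↥(cubes i.D.toDomains) → Module.End ℂ (FBondY i → 𝔸))
    (hP1 : ∀ c, Pl c * cutMulY (hBdY i (hTY i c)) = cutMulY (hBdY i (hTY i c)) * Pl c + P1l c)
    (hlocT : ∀ c, cutMulY (hBdY i (hTY i c)) * Gl c * (deltaLocY i parB U - Pl c) * cutMulY (hBdY i (hTY i c)) =
      cutMulY (hBdY i (hTY i c)) * cutMulY (hBdY i (hTY i c))) :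
    (∑ c, cutMulY (hBdY i (hTY i c)) * Gl c * cutMulY (hBdY i (hTY i c))) * deltaAY i parS parB Gp U =
      1 + ∑ c, cutMulY (hBdY i (hTY i c)) * Gl c * KhBY i (hTY i c) parB U
        + ∑ c, cutMulY (hBdY i (hTY i c)) * Gl c * P1l c
        - ∑ c, cutMulY (hBdY i (hTY i c)) * Gl c * cutMulY (hBdY i (hTY i c)) * (cutMulY (hBdY i (ζ c)) * (DPDsY i parS Gp U - Pl c))
        - ∑ c, cutMulY (hBdY i (hTY i c)) * Gl c * cutMulY (hBdY i (hTY i c)) * ((1 - cutMulY (hBdY i (ζ c))) * DPDsY i parS Gp U) := by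
  have h := eq3105T_hT_defect i parS parB Gp U ζ hζ Gl Pl P1l (fun _ => 0) hP1 (fun c => by rw [hlocT c, sub_zero])
  rw [Finset.sum_const_zero, sub_zero] at h
  exact h

/-- THE RECORD LETTERS ARE AN INSTANCE WITH ZERO DEFECT: for r05's `G_□(U) = GACubeY i □ parS parB U`, `Pl_□ = DP_□D*(U) = DPDsCubeY i □ parS U`, with `Δ_{a,□}(U)`
invertible, the LEFT law holds exactly (`B9Eq3105AtLetters.hloc_GACubeY` + r05's NearH rows agreement `B9CubeBondRowAgreementNearH.QsaQCubeY_apply_eq_of_hT`).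
[cite: Balaban1985BackgroundPropagators, (3.87) p.409, p.409 l.3–5, p.408 («Ω_n(□) ⊂ Ω_n»)] -/
theorem hdef_GACubeY (c : ↥(cubes i.D.toDomains)) (parS : SiteParY 𝔸 i) (parB : BondParY 𝔸 i) (U : CfgY 𝔸 i)
    (hinv : IsUnit (deltaACubeY i c parS parB U)) :
    cutMulY (hBdY i (hTY i c)) * (deltaLocY i parB U - DPDsCubeY i c parS U) * GACubeY i c parS parB U * cutMulY (hBdY i (hTY i c)) =
      cutMulY (hBdY i (hTY i c)) * cutMulY (hBdY i (hTY i c)) - 0 := by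
  rw [sub_zero]
  exact hloc_GACubeY i c parS parB U (hTY i c) hinv fun A f hf => QsaQCubeY_apply_eq_of_hT i c parB U A f hf

/-- … and the RIGHT law (`B9Eq3105TAtLetters.hlocT_GACubeY` + the column agreement `B9Eq3105TAtLettersNearH.QsaQCubeY_cutMulY_hT_apply_eq`).
[cite: Balaban1985BackgroundPropagators, (3.87) p.409, p.409 l.3–5, p.408] -/
theorem hdefT_GACubeY (c : ↥(cubes i.D.toDomains)) (parS : SiteParY 𝔸 i) (parB : BondParY 𝔸 i) (U : CfgY 𝔸 i)
    (hinv : IsUnit (deltaACubeY i c parS parB U)) :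
    cutMulY (hBdY i (hTY i c)) * GACubeY i c parS parB U * (deltaLocY i parB U - DPDsCubeY i c parS U) * cutMulY (hBdY i (hTY i c)) =
      cutMulY (hBdY i (hTY i c)) * cutMulY (hBdY i (hTY i c)) - 0 := by
  rw [sub_zero]
  exact hlocT_GACubeY i c parS parB U (hTY i c) hinv fun A f => QsaQCubeY_cutMulY_hT_apply_eq i c parB U A f

/-- (3.101) for the record projection letter: `DP_□D*(U)·M_h = M_h·DP_□D*(U) + P_{□,1}(∂h)(U)` (`B9Eq3105AtLetters.DPDsCubeY_mul_cutMulY`) — the `hP1` input at the record letters.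
[cite: Balaban1985BackgroundPropagators, (3.101) p.414] -/
theorem hP1_DPDsCubeY (c : ↥(cubes i.D.toDomains)) (parS : SiteParY 𝔸 i) (U : CfgY 𝔸 i) :
    DPDsCubeY i c parS U * cutMulY (hBdY i (hTY i c)) = cutMulY (hBdY i (hTY i c)) * DPDsCubeY i c parS U + P1CubeY i c (hTY i c) parS U :=
  DPDsCubeY_mul_cutMulY i c (hTY i c) parS U

end Record

/-! ## §4 `End_ℂ → End_ℝ`: the identities after restricting scalars -/

section Restrict

/-- ★ **(3.105) WITH THE DEFECT FAMILY IN `End_ℝ`**: `eq3105_hT_defect` read after `restrictScalars ℝ`, the five families as whole ℂ-letters restricted.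
DEFECT LABEL: the defect family `Σ_□E_□` (resp. `Σ_□E♯_□`) is an (R)-design term, NOT in print; `= 0` for print's `G_□ = (Δ_{loc,□} − DP_□D*)⁻¹` on the cube sequence (p. 409 l. 3–5) and for r05's `GACubeY` letters. [cite: Balaban1985BackgroundPropagators, (3.105) p.414, (3.87) p.409] -/
theorem eq3105_restrict_defect (parS : SiteParY 𝔸 i) (parB : BondParY 𝔸 i) (Gp : SiteOpY 𝔸 i) (U : CfgY 𝔸 i)
    (ζ : ↥(cubes i.D.toDomains) → SiteY i → ℝ) (hζ : ∀ c z, hTY i c z ≠ 0 → ζ c z = 1)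
    (Gl Pl P1l E : ↥(cubes i.D.toDomains) → Module.End ℂ (FBondY i → 𝔸))
    (hP1 : ∀ c, Pl c * cutMulY (hBdY i (hTY i c)) = cutMulY (hBdY i (hTY i c)) * Pl c + P1l c)
    (hdef : ∀ c, cutMulY (hBdY i (hTY i c)) * (deltaLocY i parB U - Pl c) * Gl c * cutMulY (hBdY i (hTY i c)) =
      cutMulY (hBdY i (hTY i c)) * cutMulY (hBdY i (hTY i c)) - E c) :
    (deltaAY i parS parB Gp U).restrictScalars ℝ *
        (∑ c, (cutMulY (𝔸 := 𝔸) (hBdY i (hTY i c))).restrictScalars ℝ * (Gl c).restrictScalars ℝ *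
          (cutMulY (𝔸 := 𝔸) (hBdY i (hTY i c))).restrictScalars ℝ) =
      1 - ∑ c, (KhBY i (hTY i c) parB U * Gl c * cutMulY (hBdY i (hTY i c))).restrictScalars ℝ
        - ∑ c, ((1 - cutMulY (hBdY i (ζ c))) * DPDsY i parS Gp U *
            (cutMulY (hBdY i (hTY i c)) * Gl c * cutMulY (hBdY i (hTY i c)))).restrictScalars ℝ
        - ∑ c, (cutMulY (hBdY i (ζ c)) * (DPDsY i parS Gp U - Pl c) *
            (cutMulY (hBdY i (hTY i c)) * Gl c * cutMulY (hBdY i (hTY i c)))).restrictScalars ℝ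
        - ∑ c, (cutMulY (hBdY i (ζ c)) * P1l c * Gl c * cutMulY (hBdY i (hTY i c))).restrictScalars ℝ
        - ∑ c, (E c).restrictScalars ℝ := by
  refine LinearMap.ext fun Λ => ?_
  have h := LinearMap.congr_fun (eq3105_hT_defect i parS parB Gp U ζ hζ Gl Pl P1l E hP1 hdef) Λ
  simp only [Module.End.mul_apply, LinearMap.sum_apply, LinearMap.sub_apply, Module.End.one_apply, LinearMap.restrictScalars_apply] at h ⊢
  exact h

/-- ★ **THE TRANSPOSED (3.105) WITH THE DEFECT FAMILY IN `End_ℝ`**. (transposed reading — bookkeeping; print displays only the left form of (3.105)) DEFECT LABEL: the defect family `Σ_□E_□` (resp. `Σ_□E♯_□`) is an (R)-design term, NOT in print; `= 0` for print's `G_□ = (Δ_{loc,□} − DP_□D*)⁻¹` on the cube sequence (p. 409 l. 3–5) and for r05's `GACubeY` letters. [cite: Balaban1985BackgroundPropagators, (3.105) p.414, (3.87) p.409] -/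
theorem eq3105T_restrict_defect (parS : SiteParY 𝔸 i) (parB : BondParY 𝔸 i) (Gp : SiteOpY 𝔸 i) (U : CfgY 𝔸 i)
    (ζ : ↥(cubes i.D.toDomains) → SiteY i → ℝ) (hζ : ∀ c z, hTY i c z ≠ 0 → ζ c z = 1)
    (Gl Pl P1l E : ↥(cubes i.D.toDomains) → Module.End ℂ (FBondY i → 𝔸))
    (hP1 : ∀ c, Pl c * cutMulY (hBdY i (hTY i c)) = cutMulY (hBdY i (hTY i c)) * Pl c + P1l c)
    (hdefT : ∀ c, cutMulY (hBdY i (hTY i c)) * Gl c * (deltaLocY i parB U - Pl c) * cutMulY (hBdY i (hTY i c)) =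
      cutMulY (hBdY i (hTY i c)) * cutMulY (hBdY i (hTY i c)) - E c) :
    (∑ c, (cutMulY (𝔸 := 𝔸) (hBdY i (hTY i c))).restrictScalars ℝ * (Gl c).restrictScalars ℝ *
          (cutMulY (𝔸 := 𝔸) (hBdY i (hTY i c))).restrictScalars ℝ) * (deltaAY i parS parB Gp U).restrictScalars ℝ =
      1 + ∑ c, (cutMulY (hBdY i (hTY i c)) * Gl c * KhBY i (hTY i c) parB U).restrictScalars ℝ
        + ∑ c, (cutMulY (hBdY i (hTY i c)) * Gl c * P1l c).restrictScalars ℝ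
        - ∑ c, (cutMulY (hBdY i (hTY i c)) * Gl c * cutMulY (hBdY i (hTY i c)) *
            (cutMulY (hBdY i (ζ c)) * (DPDsY i parS Gp U - Pl c))).restrictScalars ℝ
        - ∑ c, (cutMulY (hBdY i (hTY i c)) * Gl c * cutMulY (hBdY i (hTY i c)) *
            ((1 - cutMulY (hBdY i (ζ c))) * DPDsY i parS Gp U)).restrictScalars ℝ
        - ∑ c, (E c).restrictScalars ℝ := by
  refine LinearMap.ext fun Λ => ?_
  have h := LinearMap.congr_fun (eq3105T_hT_defect i parS parB Gp U ζ hζ Gl Pl P1l E hP1 hdefT) Λ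
  simp only [Module.End.mul_apply, LinearMap.sum_apply, LinearMap.sub_apply, LinearMap.add_apply, Module.End.one_apply,
    LinearMap.restrictScalars_apply] at h ⊢
  exact h

end Restrict

/-! ## §5 Through the real coordinates of a basis `b`: the `h388` ∕ `h388T` shapes of the summation engines, generic letters -/

section Conj

variable {ι : Type} [Fintype ι] (b : Module.Basis ι ℝ 𝔸)

/-- ★★ **(3.105) WITH THE DEFECT FAMILY IN REAL COORDINATES**: with `h_□` read on the coordinates as `mulOp (h_□ ∘ fst)` and the cube letters as `conj b Gl_□`:
`conj b Δ_a(U) · Σ_□ mulOp h_□ · conj b Gl_□ · mulOp h_□ = 1 − (Σ_□ conj b R¹_□ + Σ_□ conj b R²_□ + Σ_□ conj b R³_□ + Σ_□ conj b R⁴_□ + Σ_□ conj b E_□)` with the four printed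
families `R¹ = K(h_□)Gl_□h_□`, `R² = (1 − ζ_□̃)DPD*(h_□Gl_□h_□)`, `R³ = ζ_□̃(DPD* − Pl_□)(h_□Gl_□h_□)`, `R⁴ = ζ_□̃P1l_□Gl_□h_□` and the defect family fifth — the `h388` input of
`B9Thm310GTorusRegular.thm310_entry1` ∕ `…Entries.thm310_leftEntry` for generic letters. DEFECT LABEL: the defect family `Σ_□E_□` (resp. `Σ_□E♯_□`) is an (R)-design term, NOT in print; `= 0` for print's `G_□ = (Δ_{loc,□} − DP_□D*)⁻¹` on the cube sequence (p. 409 l. 3–5) and for r05's `GACubeY` letters. [cite: Balaban1985BackgroundPropagators, (3.105) p.414, (3.87) p.409; Balaban1984PropagatorsII, (2.52) p.232] -/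
theorem eq3105_conj_defect (parS : SiteParY 𝔸 i) (parB : BondParY 𝔸 i) (Gp : SiteOpY 𝔸 i) (U : CfgY 𝔸 i)
    (ζ : ↥(cubes i.D.toDomains) → SiteY i → ℝ) (hζ : ∀ c z, hTY i c z ≠ 0 → ζ c z = 1)
    (Gl Pl P1l E : ↥(cubes i.D.toDomains) → Module.End ℂ (FBondY i → 𝔸))
    (hP1 : ∀ c, Pl c * cutMulY (hBdY i (hTY i c)) = cutMulY (hBdY i (hTY i c)) * Pl c + P1l c)
    (hdef : ∀ c, cutMulY (hBdY i (hTY i c)) * (deltaLocY i parB U - Pl c) * Gl c * cutMulY (hBdY i (hTY i c)) =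
      cutMulY (hBdY i (hTY i c)) * cutMulY (hBdY i (hTY i c)) - E c) :
    conj b ((deltaAY i parS parB Gp U).restrictScalars ℝ) *
        (∑ c, mulOp (fun p : FBondY i × ι => hBdY i (hTY i c) p.1) * conj b ((Gl c).restrictScalars ℝ) *
          mulOp (fun p : FBondY i × ι => hBdY i (hTY i c) p.1)) =
      1 - (∑ c, conj b ((KhBY i (hTY i c) parB U * Gl c * cutMulY (hBdY i (hTY i c))).restrictScalars ℝ)
        + ∑ c, conj b (((1 - cutMulY (hBdY i (ζ c))) * DPDsY i parS Gp U *
            (cutMulY (hBdY i (hTY i c)) * Gl c * cutMulY (hBdY i (hTY i c)))).restrictScalars ℝ)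
        + ∑ c, conj b ((cutMulY (hBdY i (ζ c)) * (DPDsY i parS Gp U - Pl c) *
            (cutMulY (hBdY i (hTY i c)) * Gl c * cutMulY (hBdY i (hTY i c)))).restrictScalars ℝ)
        + ∑ c, conj b ((cutMulY (hBdY i (ζ c)) * P1l c * Gl c * cutMulY (hBdY i (hTY i c))).restrictScalars ℝ)
        + ∑ c, conj b ((E c).restrictScalars ℝ)) := by
  have h := congrArg (conj b) (eq3105_restrict_defect i parS parB Gp U ζ hζ Gl Pl P1l E hP1 hdef)
  rw [B9Eq352DivFormLetters.conj_mul, conj_sum] at h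
  simp only [B9Eq352DivFormLetters.conj_mul, conj_cutMulY, conj_sub, conj_one, conj_sum] at h
  rw [h]
  abel

/-- ★★ **THE TRANSPOSED (3.105) WITH THE DEFECT FAMILY IN REAL COORDINATES**:
`(Σ_□ mulOp h_□ · conj b Gl_□ · mulOp h_□) · conj b Δ_a(U) = 1 − (−Σ conj b V¹ − Σ conj b V² + Σ conj b V³ + Σ conj b V⁴ + Σ conj b E♯)` with `V¹ = h_□Gl_□K(h_□)`,
`V² = h_□Gl_□P1l_□`, `V³ = (h_□Gl_□h_□)ζ_□̃(DPD* − Pl_□)`, `V⁴ = (h_□Gl_□h_□)(1 − ζ_□̃)DPD*` — the `h388T` input of `…Entries.thm310_rightEntry` for generic letters.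
(transposed reading — bookkeeping; print displays only the left form of (3.105)) DEFECT LABEL: the defect family `Σ_□E_□` (resp. `Σ_□E♯_□`) is an (R)-design term, NOT in print; `= 0` for print's `G_□ = (Δ_{loc,□} − DP_□D*)⁻¹` on the cube sequence (p. 409 l. 3–5) and for r05's `GACubeY` letters. [cite: Balaban1985BackgroundPropagators, (3.105) p.414, (3.87) p.409; Balaban1984PropagatorsII, (2.52) p.232] -/
theorem eq3105T_conj_defect (parS : SiteParY 𝔸 i) (parB : BondParY 𝔸 i) (Gp : SiteOpY 𝔸 i) (U : CfgY 𝔸 i)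
    (ζ : ↥(cubes i.D.toDomains) → SiteY i → ℝ) (hζ : ∀ c z, hTY i c z ≠ 0 → ζ c z = 1)
    (Gl Pl P1l E : ↥(cubes i.D.toDomains) → Module.End ℂ (FBondY i → 𝔸))
    (hP1 : ∀ c, Pl c * cutMulY (hBdY i (hTY i c)) = cutMulY (hBdY i (hTY i c)) * Pl c + P1l c)
    (hdefT : ∀ c, cutMulY (hBdY i (hTY i c)) * Gl c * (deltaLocY i parB U - Pl c) * cutMulY (hBdY i (hTY i c)) =
      cutMulY (hBdY i (hTY i c)) * cutMulY (hBdY i (hTY i c)) - E c) :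
    (∑ c, mulOp (fun p : FBondY i × ι => hBdY i (hTY i c) p.1) * conj b ((Gl c).restrictScalars ℝ) *
          mulOp (fun p : FBondY i × ι => hBdY i (hTY i c) p.1)) * conj b ((deltaAY i parS parB Gp U).restrictScalars ℝ) =
      1 - (-(∑ c, conj b ((cutMulY (hBdY i (hTY i c)) * Gl c * KhBY i (hTY i c) parB U).restrictScalars ℝ))
        - ∑ c, conj b ((cutMulY (hBdY i (hTY i c)) * Gl c * P1l c).restrictScalars ℝ)
        + ∑ c, conj b ((cutMulY (hBdY i (hTY i c)) * Gl c * cutMulY (hBdY i (hTY i c)) *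
            (cutMulY (hBdY i (ζ c)) * (DPDsY i parS Gp U - Pl c))).restrictScalars ℝ)
        + ∑ c, conj b ((cutMulY (hBdY i (hTY i c)) * Gl c * cutMulY (hBdY i (hTY i c)) *
            ((1 - cutMulY (hBdY i (ζ c))) * DPDsY i parS Gp U)).restrictScalars ℝ)
        + ∑ c, conj b ((E c).restrictScalars ℝ)) := by
  have h := congrArg (conj b) (eq3105T_restrict_defect i parS parB Gp U ζ hζ Gl Pl P1l E hP1 hdefT)
  rw [B9Eq352DivFormLetters.conj_mul, conj_sum] at h
  simp only [B9Eq352DivFormLetters.conj_mul, conj_cutMulY, conj_sub, conj_add, conj_one, conj_sum] at h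
  rw [h]
  abel

end Conj

end Literature.MathematicalPhysics.QuantumFieldTheory.Balaban1983to89.B9Eq3105OfLocalInverse

end
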